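import Literature.NumberTheory.EllipticCurves.TowerStrictCorePropagationProofs
import Literature.Algebra.Homology.DiscreteRepGaloisCorollaries
import HarnessLib

/-!
# Residual strict classes lift to the strict core when `H²` of the kernel vanishes (theorems only)

`Proofs` file (theorems only; no definition, no named fact, no instance, no `sorry`).  Topic `NumberTheory/EllipticCurves`
(cell `pub/bsd-print-x9`, memo `HOME/x9-p1-w3/H5B-AT-P-PLAN-w3g5.md`, file V4a: the input (LIFT) of
`Tower.map_levelCondition_one_eq_strictSubgroup` (V1, `TowerStrictCorePropagationProofs`) from the vanishing of an `H²`).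

For discrete `Γ_F`-modules `X`, `N`, an equivariant `π : X → N`, stable subgroups `P ≤ X`, `Q ≤ N` with `π(P) = Q`, and the
kernel `K = P ∩ ker π`: if **`H²(F, K) = 0`** then `H¹(F, P) → H¹(F, Q)` is onto (long exact sequence,
`DiscreteRep.galoisCohomology_exact₃`), hence **every class of the strict kernel `H¹_str(F, Q) = ker (H¹(F, N) → H¹(F, N/Q))`
is `H¹(π) x` for some `x ∈ H¹_str(F, P)`** (`exists_mem_strictSubgroup_map_eq_of_subsingleton_kernel`; companion of x10b-p1-w6's `TowerPresentedSubquotientCohomologyProofs`, which lifts core classes along the REDUCTIONS of a presented tower): strict classes are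
represented by `Q`-valued cocycles (§1), which lift to `P`-valued cocycles.  For Howard's `F_𝔮` at `v ∣ p` this is the
per-level lifting `H¹(K_v, Fil_v W_j) ↠ H¹(K_v, Fil_v E[p])` for non-anomalous `v` (`H²(K_v, ·) = 0` by local duality).
No summit statement is proved; BSD is not proved by any of this.  Seat `bsd-line-x9-p1-w3` g5.

References: [Howard2004HeegnerKolyvagin] §3.1–3.2 (arXiv:1202.6340 p. 15 L62–66, p. 16 L5–6); [GreenbergLNM1716] §2;
[SerreGaloisCohomology1997] I §2.2, §5.8; [Harari2020] Thm. 1.17.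
-/

set_option autoImplicit false

noncomputable section

open CategoryTheory Field Function
open scoped ContRepresentation

namespace Literature.NumberTheory.EllipticCurves

namespace Tower

open Literature.NumberTheory.GaloisRepresentations Literature.Algebra.Homology

variable {F : Type} [Field F] {X : Type} [AddCommGroup X] [TopologicalSpace X] [DiscreteTopology X]
  {N : Type} [AddCommGroup N] [TopologicalSpace N] [DiscreteTopology N]
  (τ : DiscreteGaloisModule F X) (σ : DiscreteGaloisModule F N)

/-! ## §1 Strict classes are represented by cocycles with values in the stable subgroup -/

/-- The class of the inclusion of a `Q`-valued cocycle lies in the strict kernel `H¹_str(F, Q)`.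
[cite: GreenbergLNM1716, §2 (the ordinary condition = image of H¹ of the plus part)] -/
theorem map_subtype_mem_strictSubgroup (Q : Submodule ℤ N) (hQ : ∀ g : absoluteGaloisGroup F, Q ≤ Q.comap (σ g))
    (ι : (σ.subrepresentation Q hQ).toContRepresentation →ⁱL σ.toContRepresentation) (hι : ∀ y, ι y = (y : N))
    (s : galoisCohomology (σ.subrepresentation Q hQ) 1) :
    galoisCohomology.map ι 1 s ∈ σ.strictSubgroup Q hQ := by
  obtain ⟨ξ, rfl⟩ := oneCocycleClass_surjective _ s
  rw [galoisCohomology.map_oneCocycleClass_ofHom]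
  change σ.quotientMap Q hQ 1 (oneCocycleClass _ _) = 0
  have hq : ∀ c, σ.quotientMap Q hQ 1 (oneCocycleClass _ c) =
      ContinuousCohomology.map (ContinuousMonoidHom.id (absoluteGaloisGroup F)) (X := σ.toTopRep)
        (Y := DiscreteGaloisModule.toTopRep (σ.quotient Q hQ))
        (TopRep.ofHom ⟨⟨Q.mkQ.toAddMonoidHom.toIntLinearMap, continuous_of_discreteTopology⟩,
          fun g ↦ ContinuousLinearMap.ext fun x ↦ rfl⟩) 1 (oneCocycleClass _ c) := fun _ ↦ rfl
  rw [hq, map_oneCocycleClass]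
  refine (oneCocycleClass_eq_zero_iff _ _).mpr ⟨0, fun g ↦ ?_⟩
  rw [map_zero, sub_zero]
  change Q.mkQ (ι (ξ.1 g)) = 0
  rw [hι, Submodule.mkQ_apply, Submodule.Quotient.mk_eq_zero]
  exact (ξ.1 g).2

/-- **A class of `H¹_str(F, Q)` is the image of a class of `H¹(F, Q)`**: its cocycle is a coboundary modulo `Q`, and
subtracting that coboundary gives a cohomologous `Q`-valued cocycle. [cite: GreenbergLNM1716, §2] [cite: SerreGaloisCohomology1997, I §5.8] -/
theorem exists_map_subtype_eq_of_mem_strictSubgroup (Q : Submodule ℤ N)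
    (hQ : ∀ g : absoluteGaloisGroup F, Q ≤ Q.comap (σ g))
    (ι : (σ.subrepresentation Q hQ).toContRepresentation →ⁱL σ.toContRepresentation) (hι : ∀ y, ι y = (y : N))
    {r : galoisCohomology σ 1} (hr : r ∈ σ.strictSubgroup Q hQ) :
    ∃ s : galoisCohomology (σ.subrepresentation Q hQ) 1, galoisCohomology.map ι 1 s = r := by
  obtain ⟨ζ, rfl⟩ := oneCocycleClass_surjective _ r
  -- the cocycle criterion (V1's private copy is re-derived through `map_strictSubgroup_le_strictSubgroup`'s proof pattern)
  have hq : σ.quotientMap Q hQ 1 (oneCocycleClass _ ζ) =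
      ContinuousCohomology.map (ContinuousMonoidHom.id (absoluteGaloisGroup F)) (X := σ.toTopRep)
        (Y := DiscreteGaloisModule.toTopRep (σ.quotient Q hQ))
        (TopRep.ofHom ⟨⟨Q.mkQ.toAddMonoidHom.toIntLinearMap, continuous_of_discreteTopology⟩,
          fun g ↦ ContinuousLinearMap.ext fun x ↦ rfl⟩) 1 (oneCocycleClass _ ζ) := rfl
  have hr' : σ.quotientMap Q hQ 1 (oneCocycleClass _ ζ) = 0 := hr
  rw [hq, map_oneCocycleClass] at hr'
  obtain ⟨q, hq'⟩ := (oneCocycleClass_eq_zero_iff _ _).mp hr'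
  obtain ⟨e, rfl⟩ := Submodule.mkQ_surjective Q q
  have hmem : ∀ g : absoluteGaloisGroup F, ζ.1 g - (σ g e - e) ∈ Q := fun g ↦ by
    have hg := hq' g
    change Q.mkQ (ζ.1 g) = Q.mkQ (σ g e) - Q.mkQ e at hg
    rw [← map_sub, Submodule.mkQ_apply, Submodule.mkQ_apply, Submodule.Quotient.eq] at hg
    exact hg
  -- the `Q`-valued cocycle `ζ - ∂e`
  have hcont : Continuous fun g : absoluteGaloisGroup F ↦ σ g e :=
    σ.continuous_smul.comp (continuous_id.prodMk continuous_const)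
  let ξ : contOneCocycles (σ.subrepresentation Q hQ).toTopRep :=
    ⟨⟨fun g ↦ ⟨ζ.1 g - (σ g e - e), hmem g⟩, (ζ.1.continuous.sub (hcont.sub continuous_const)).subtype_mk _⟩,
      fun g h ↦ by
      apply Subtype.ext
      change ζ.1 (g * h) - (σ (g * h) e - e) = (ζ.1 g - (σ g e - e)) + σ g (ζ.1 h - (σ h e - e))
      rw [ζ.2 g h, map_mul, Module.End.mul_apply, map_sub, map_sub]
      change ζ.1 g + σ g (ζ.1 h) - _ = _
      abel⟩
  refine ⟨oneCocycleClass _ ξ, ?_⟩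
  -- the two cocycles differ by the coboundary of `e`
  rw [galoisCohomology.map_oneCocycleClass_ofHom]
  have key : oneCocycleClass σ.toTopRep (contOneCocycles.pullback (ContinuousMonoidHom.id (absoluteGaloisGroup F))
      (X := (σ.subrepresentation Q hQ).toTopRep) (Y := σ.toTopRep)
      (TopRep.ofHom ⟨ι.toContinuousLinearMap, ι.isIntertwining'⟩) ξ) - oneCocycleClass σ.toTopRep ζ = 0 := by
    rw [← oneCocycleClass_sub, oneCocycleClass_eq_zero_iff]
    refine ⟨-e, fun g ↦ ?_⟩
    change ι (ξ.1 g) - ζ.1 g = σ g (-e) - (-e)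
    rw [hι]
    change (ζ.1 g - (σ g e - e)) - ζ.1 g = σ g (-e) - (-e)
    rw [map_neg]; abel
  exact sub_eq_zero.mp key

/-! ## §2 Lifting strict classes along `π` when `H²` of the kernel vanishes -/

/-- **(LIFT) Every class of `H¹_str(F, Q)` is `H¹(π) x` with `x ∈ H¹_str(F, P)`** when `π(P) = Q` and `H²(F, K) = 0` for the
kernel `K = P ∩ ker π`: the long exact sequence of `0 → K → P → Q → 0` makes `H¹(F, P) → H¹(F, Q)` onto.
[cite: Howard2004HeegnerKolyvagin, §3.1–3.2 (arXiv p. 15 L62–66, p. 16 L5–6)] [cite: Harari2020, Thm. 1.17] [cite: GreenbergLNM1716, §2] -/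
theorem exists_mem_strictSubgroup_map_eq_of_subsingleton_kernel (π : τ.toContRepresentation →ⁱL σ.toContRepresentation)
    (P : Submodule ℤ X) (hP : ∀ g : absoluteGaloisGroup F, P ≤ P.comap (τ g))
    (Q : Submodule ℤ N) (hQ : ∀ g : absoluteGaloisGroup F, Q ≤ Q.comap (σ g))
    (hπPQ : ∀ x ∈ P, π x ∈ Q) (hsurj : ∀ y ∈ Q, ∃ x ∈ P, π x = y)
    (K : Submodule ℤ X) (hK : ∀ g : absoluteGaloisGroup F, K ≤ K.comap (τ g)) (hKP : K ≤ P)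
    (hKπ : ∀ x ∈ K, π x = 0) (hKex : ∀ x ∈ P, π x = 0 → x ∈ K)
    [Subsingleton (galoisCohomology (τ.subrepresentation K hK) 2)]
    {r : galoisCohomology σ 1} (hr : r ∈ σ.strictSubgroup Q hQ) :
    ∃ x ∈ τ.strictSubgroup P hP, galoisCohomology.map π 1 x = r := by
  haveI := absoluteGaloisGroup_compactSpace F
  have hπsmul : ∀ (g : absoluteGaloisGroup F) (x : X), π (τ g x) = σ g (π x) :=
    fun g x ↦ congrArg (fun φ ↦ φ x) (π.isIntertwining' g)
  -- the four equivariant maps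
  let ιP : (τ.subrepresentation P hP).toContRepresentation →ⁱL τ.toContRepresentation :=
    { toContinuousLinearMap := ⟨P.subtype, continuous_subtype_val⟩
      isIntertwining' := fun g ↦ by ext x; rfl }
  let ιQ : (σ.subrepresentation Q hQ).toContRepresentation →ⁱL σ.toContRepresentation :=
    { toContinuousLinearMap := ⟨Q.subtype, continuous_subtype_val⟩
      isIntertwining' := fun g ↦ by ext x; rfl }
  let πPQ : (τ.subrepresentation P hP).toContRepresentation →ⁱL (σ.subrepresentation Q hQ).toContRepresentation :=
    { toContinuousLinearMap :=
        ⟨(π.toContinuousLinearMap.toLinearMap.comp P.subtype).codRestrict Q (fun x ↦ hπPQ x x.2),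
          continuous_of_discreteTopology⟩
      isIntertwining' := fun g ↦ by
        ext x
        exact hπsmul g x }
  let ιKP : (τ.subrepresentation K hK).toContRepresentation →ⁱL (τ.subrepresentation P hP).toContRepresentation :=
    { toContinuousLinearMap := ⟨Submodule.inclusion hKP, continuous_of_discreteTopology⟩
      isIntertwining' := fun g ↦ by ext x; rfl }
  let h : (τ.subrepresentation P hP).toContRepresentation →ⁱL σ.toContRepresentation :=
    { toContinuousLinearMap := ⟨π.toContinuousLinearMap.toLinearMap.comp P.subtype, continuous_of_discreteTopology⟩
      isIntertwining' := fun g ↦ by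
        ext x
        exact hπsmul g x }
  -- `r` comes from `H¹(F, Q)`
  obtain ⟨s, rfl⟩ := exists_map_subtype_eq_of_mem_strictSubgroup σ Q hQ ιQ (fun _ ↦ rfl) hr
  -- `H¹(F, P) → H¹(F, Q)` is onto
  have hex3 := DiscreteRep.galoisCohomology_exact₃ (τ.subrepresentation K hK) (τ.subrepresentation P hP)
    (σ.subrepresentation Q hQ) ιKP πPQ (fun x ↦ Subtype.ext (hKπ x x.2)) (Submodule.inclusion_injective hKP)
    (fun y ↦ by
      obtain ⟨x, hx, hxy⟩ := hsurj y y.2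
      exact ⟨⟨x, hx⟩, Subtype.ext hxy⟩)
    (fun y hy ↦ ⟨⟨y, hKex y y.2 (congrArg Subtype.val hy)⟩, rfl⟩) 1
  obtain ⟨s', hs'⟩ := (hex3 s).mp (Subsingleton.elim _ _)
  refine ⟨galoisCohomology.map ιP 1 s', map_subtype_mem_strictSubgroup τ P hP ιP (fun _ ↦ rfl) s', ?_⟩
  rw [galoisCohomology.map_map_of_comp_apply ιP π h (fun _ ↦ rfl), ← hs',
    galoisCohomology.map_map_of_comp_apply πPQ ιQ h (fun _ ↦ rfl)]

end Tower

end Literature.NumberTheory.EllipticCurves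

end
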